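import Mathlib
import HarnessLib
import Literature.NumberTheory.Sieve.SelbergSymmetryFormula
import Literature.NumberTheory.Sieve.AsymptoticSieveForPrimesReduction

/-!
# Route `IntegerScrew` — the von Mangoldt COUPLING FORM is bounded by `log M + 6`

The RH-free arithmetic half of the «Nyquist operator norm» of HOME/pivot/PIVOT-LAW.md §13 (LEMMA N (i)).
For a real vector `c = (c_m)_{1 ≤ m ≤ M}` put
`B_M(c) := ∑_{m ≥ 1, n ≥ 1, mn ≤ M} Λ(n) n^{-1/2} c_{mn} c_m`
(the term `n = 1` vanishes since `Λ(1) = 0`).  `2·B_M(c) = cᵀ N_M c` for the symmetric `M × M` matrix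
`N_M` with entries `Λ(n) n^{-1/2}` at the positions `(mn, m)` and `(m, mn)`.  Under RH, by Weil's explicit
formula read with a band-limited spectral window `w` (Fourier support in `(−1/(M+1), 1/(M+1))`), the
window energy `∑_γ w(γ) |∑_m c_m m^{iγ}|²` of a Dirichlet polynomial of length `M` over the zeros of `ζ`
equals `(ŵ(0)/2π)·[log(T/2π)·‖c‖² − 2 B_M(c)]` up to two explicitly small terms (PIVOT-LAW §13 LEMMA W):
`2 B_M(c)` is the Landau–Gonek correlation `∑_γ x^{iγ} ↔ −Λ(x)/√x` as a quadratic form, and its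
operator norm decides down to which height `T ≍ M` the correlation can cancel the zero density.

This file proves the elementary upper bound (weighted AM–GM + `∑_{d ∣ k} Λ(d) = log k` + Mertens):

* `two_mul_abs_vonMangoldtCoupling_le` :
  `2 |B_M(c)| ≤ ∑_{k ≤ M} (log k + ∑_{n ≤ M/k} Λ(n)/n) · c_k²`;
* `two_mul_abs_vonMangoldtCoupling_le_log` : `2 |B_M(c)| ≤ (log M + 6) · ∑_{k ≤ M} c_k²`,

i.e. `ν_max(N_M) ≤ log M + 6`.  (Numerically `ν_max(N_M) = log M − γ₀ + O(1/log M)`, the flat vector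
`c_m = m^{-1/2}` giving `log M − γ₀ + 0.19/log M`; PIVOT-LAW §13.2.)  Inputs: the tree's Mertens estimate
`|∑_{n ≤ x} Λ(n)/n − log x| ≤ 6` (`Literature.NumberTheory.Sieve.SelbergSymmetry.abs_sum_vonMangoldt_div_sub_log_le`)
and the rearrangement `∑_m ∑_{n ≤ X/m} ≤ ∑_{k ≤ X} ∑_{mn = k}`
(`Literature.NumberTheory.Sieve.sum_sum_le_sum_divisorsAntidiagonal`).  Nothing here bears on the truth of
RH: the statements are unconditional facts about von Mangoldt's function.

References: H. L. Montgomery, R. C. Vaughan, *Multiplicative Number Theory I* (2007), Thm 12.13 (Weil's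
explicit formula) for the context; M. Suzuki, J. Lond. Math. Soc. (2) 108 (2023) 1448–1487 [Suzuki2023]
for the screw matrices `S_M` whose intercept energy `𝟙ᵀ S_M⁻¹ 𝟙` the coupling form controls.
-/

noncomputable section

-- D-0017: `Summit.<S>.<S>.…` is the designed namespace of a single-problem summit.
set_option linter.dupNamespace false

namespace Summit.RiemannHypothesis.RiemannHypothesis.Theorems.IntegerScrew

open Finset ArithmeticFunction


/-- Weighted AM–GM for one term of the coupling form: `2·Λ(n) n^{-1/2} |a| |b| ≤ Λ(n)·a² + (Λ(n)/n)·b²`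
for `n ≥ 1`. -/
theorem two_mul_vonMangoldt_div_sqrt_mul_le {n : ℕ} (hn : 1 ≤ n) (a b : ℝ) :
    2 * (Λ n / Real.sqrt n * (|a| * |b|)) ≤ Λ n * a ^ 2 + Λ n / n * b ^ 2 := by
  have hn0 : (0 : ℝ) < n := by exact_mod_cast hn
  set s : ℝ := Real.sqrt n with hs
  have hs0 : 0 < s := Real.sqrt_pos.mpr hn0
  have hss : s ^ 2 = (n : ℝ) := by rw [hs, Real.sq_sqrt hn0.le]
  have hΛ : 0 ≤ Λ n := vonMangoldt_nonneg
  have key : 0 ≤ Λ n * (s * |a| - |b|) ^ 2 := mul_nonneg hΛ (sq_nonneg _)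
  have h1 : 2 * (Λ n / s * (|a| * |b|)) = (2 * Λ n * s * |a| * |b|) / s ^ 2 := by
    field_simp
  have h2 : Λ n * a ^ 2 + Λ n / n * b ^ 2 = (Λ n * s ^ 2 * a ^ 2 + Λ n * b ^ 2) / s ^ 2 := by
    rw [← hss]
    field_simp
  rw [h1, h2]
  apply div_le_div_of_nonneg_right _ (by positivity)
  have ha : |a| ^ 2 = a ^ 2 := sq_abs a
  have hb : |b| ^ 2 = b ^ 2 := sq_abs b
  have hexp : Λ n * (s * |a| - |b|) ^ 2 =
      Λ n * s ^ 2 * |a| ^ 2 - 2 * Λ n * s * |a| * |b| + Λ n * |b| ^ 2 := by ring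
  rw [hexp, ha, hb] at key
  linarith

/-- `∑_{n ≤ X} Λ(n)/n ≤ log X + 6` for `X ≥ 1` (the tree's explicit Mertens estimate). -/
theorem sum_vonMangoldt_div_self_le {X : ℕ} (hX : 1 ≤ X) :
    ∑ n ∈ Icc 1 X, Λ n / n ≤ Real.log X + 6 := by
  have h := Literature.NumberTheory.Sieve.SelbergSymmetry.abs_sum_vonMangoldt_div_sub_log_le
    (x := (X : ℝ)) (by exact_mod_cast hX)
  rw [Nat.floor_natCast] at h
  have hI : Icc 1 X = Ioc 0 X := by ext m; simp only [mem_Icc, mem_Ioc]; omega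
  rw [hI]
  have := (abs_le.1 h).2
  linarith

/-- `∑_{n ≤ M/k} Λ(n)/n ≤ log M − log k + 6` for `1 ≤ k ≤ M` (natural division). -/
theorem sum_vonMangoldt_div_self_le_log_sub {M k : ℕ} (hk : k ∈ Icc 1 M) :
    ∑ n ∈ Icc 1 (M / k), Λ n / n ≤ Real.log M - Real.log k + 6 := by
  obtain ⟨hk1, hkM⟩ := mem_Icc.1 hk
  have hX1 : 1 ≤ M / k := (Nat.le_div_iff_mul_le (by omega)).2 (by simpa using hkM)
  have h := sum_vonMangoldt_div_self_le hX1
  have hkpos : (0 : ℝ) < k := by exact_mod_cast hk1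
  have hMpos : (0 : ℝ) < M := by exact_mod_cast (show 0 < M by omega)
  have hXpos : (0 : ℝ) < (M / k : ℕ) := by exact_mod_cast hX1
  have hlog : Real.log ((M / k : ℕ) : ℝ) ≤ Real.log M - Real.log k := by
    rw [← Real.log_div hMpos.ne' hkpos.ne']
    exact Real.log_le_log hXpos Nat.cast_div_le
  linarith

/-- The square part of the coupling bound, rearranged over `k = mn`:
`∑_{m ≤ M} ∑_{n ≤ M/m} Λ(n) c_{mn}² ≤ ∑_{k ≤ M} (log k) c_k²` (in fact equality). -/
theorem sum_sum_vonMangoldt_mul_sq_le (M : ℕ) (c : ℕ → ℝ) :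
    ∑ m ∈ Icc 1 M, ∑ n ∈ Icc 1 (M / m), Λ n * c (m * n) ^ 2 ≤
      ∑ k ∈ Icc 1 M, Real.log k * c k ^ 2 := by
  have h := Literature.NumberTheory.Sieve.sum_sum_le_sum_divisorsAntidiagonal
    (f := fun m n => Λ n * c (m * n) ^ 2) (fun m n => mul_nonneg vonMangoldt_nonneg (sq_nonneg _)) M
    (Icc 1 M) (fun m => Icc 1 (M / m)) (by
      intro m hm n hn
      obtain ⟨hm1, _⟩ := mem_Icc.1 hm
      obtain ⟨hn1, hnM⟩ := mem_Icc.1 hn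
      refine ⟨hm1, hn1, ?_⟩
      have := (Nat.le_div_iff_mul_le (by omega)).1 hnM
      simpa [Nat.mul_comm] using this)
  refine h.trans (le_of_eq ?_)
  have hI : Ioc 0 M = Icc 1 M := by ext m; simp only [mem_Icc, mem_Ioc]; omega
  rw [hI]
  refine sum_congr rfl fun k hk => ?_
  have hk0 : k ≠ 0 := by have := (mem_Icc.1 hk).1; omega
  calc ∑ p ∈ k.divisorsAntidiagonal, Λ p.2 * c (p.1 * p.2) ^ 2
      = ∑ p ∈ k.divisorsAntidiagonal, Λ p.2 * c k ^ 2 := by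
        refine sum_congr rfl fun p hp => ?_
        rw [(Nat.mem_divisorsAntidiagonal.1 hp).1]
    _ = (∑ p ∈ k.divisorsAntidiagonal, Λ p.2) * c k ^ 2 := by rw [sum_mul]
    _ = (∑ d ∈ k.divisors, Λ d) * c k ^ 2 := by
        rw [Nat.sum_divisorsAntidiagonal' (fun _ b => (Λ b : ℝ))]
    _ = Real.log k * c k ^ 2 := by rw [vonMangoldt_sum]

/-- **LEMMA N (i)** (PIVOT-LAW §13.2): the von Mangoldt coupling form of a real vector of length `M`,
`B_M(c) = ∑_{m ≤ M} ∑_{n ≤ M/m} Λ(n) n^{-1/2} c_{mn} c_m`, satisfies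
`2 |B_M(c)| ≤ ∑_{k ≤ M} (log k + ∑_{n ≤ M/k} Λ(n)/n) c_k²`. -/
theorem two_mul_abs_vonMangoldtCoupling_le (M : ℕ) (c : ℕ → ℝ) :
    2 * |∑ m ∈ Icc 1 M, ∑ n ∈ Icc 1 (M / m), Λ n / Real.sqrt n * (c (m * n) * c m)| ≤
      ∑ k ∈ Icc 1 M, (Real.log k + ∑ n ∈ Icc 1 (M / k), Λ n / n) * c k ^ 2 := by
  -- termwise absolute values
  have habs : |∑ m ∈ Icc 1 M, ∑ n ∈ Icc 1 (M / m), Λ n / Real.sqrt n * (c (m * n) * c m)| ≤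
      ∑ m ∈ Icc 1 M, ∑ n ∈ Icc 1 (M / m), Λ n / Real.sqrt n * (|c (m * n)| * |c m|) := by
    refine (abs_sum_le_sum_abs _ _).trans (sum_le_sum fun m _ => ?_)
    refine (abs_sum_le_sum_abs _ _).trans (sum_le_sum fun n _ => ?_)
    rw [abs_mul, abs_mul, abs_of_nonneg (div_nonneg vonMangoldt_nonneg (Real.sqrt_nonneg _))]
  -- termwise AM–GM
  have hamgm : 2 * ∑ m ∈ Icc 1 M, ∑ n ∈ Icc 1 (M / m), Λ n / Real.sqrt n * (|c (m * n)| * |c m|) ≤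
      ∑ m ∈ Icc 1 M, ∑ n ∈ Icc 1 (M / m), (Λ n * c (m * n) ^ 2 + Λ n / n * c m ^ 2) := by
    rw [mul_sum]
    refine sum_le_sum fun m _ => ?_
    rw [mul_sum]
    refine sum_le_sum fun n hn => ?_
    exact two_mul_vonMangoldt_div_sqrt_mul_le (mem_Icc.1 hn).1 _ _
  -- split and rearrange
  have hsplit : ∑ m ∈ Icc 1 M, ∑ n ∈ Icc 1 (M / m), (Λ n * c (m * n) ^ 2 + Λ n / n * c m ^ 2) =
      (∑ m ∈ Icc 1 M, ∑ n ∈ Icc 1 (M / m), Λ n * c (m * n) ^ 2) +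
        ∑ m ∈ Icc 1 M, (∑ n ∈ Icc 1 (M / m), Λ n / n) * c m ^ 2 := by
    rw [← sum_add_distrib]
    refine sum_congr rfl fun m _ => ?_
    rw [sum_add_distrib, sum_mul]
  have hsq := sum_sum_vonMangoldt_mul_sq_le M c
  calc 2 * |∑ m ∈ Icc 1 M, ∑ n ∈ Icc 1 (M / m), Λ n / Real.sqrt n * (c (m * n) * c m)|
      ≤ 2 * ∑ m ∈ Icc 1 M, ∑ n ∈ Icc 1 (M / m), Λ n / Real.sqrt n * (|c (m * n)| * |c m|) := by
        linarith
    _ ≤ (∑ m ∈ Icc 1 M, ∑ n ∈ Icc 1 (M / m), Λ n * c (m * n) ^ 2) +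
        ∑ m ∈ Icc 1 M, (∑ n ∈ Icc 1 (M / m), Λ n / n) * c m ^ 2 := by rw [← hsplit]; exact hamgm
    _ ≤ (∑ k ∈ Icc 1 M, Real.log k * c k ^ 2) +
        ∑ m ∈ Icc 1 M, (∑ n ∈ Icc 1 (M / m), Λ n / n) * c m ^ 2 := by linarith
    _ = ∑ k ∈ Icc 1 M, (Real.log k + ∑ n ∈ Icc 1 (M / k), Λ n / n) * c k ^ 2 := by
        rw [← sum_add_distrib]
        refine sum_congr rfl fun k _ => ?_
        ring

/-- **LEMMA N (i), closed form** (PIVOT-LAW §13.2): `2 |B_M(c)| ≤ (log M + 6)·∑_{k ≤ M} c_k²` for every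
`M` and every real `c` (both sides vanish for `M = 0`) — the top eigenvalue of the von Mangoldt coupling matrix `N_M` is at most
`log M + 6` (numerically `log M − γ₀ + O(1/log M)`). -/
theorem two_mul_abs_vonMangoldtCoupling_le_log (M : ℕ) (c : ℕ → ℝ) :
    2 * |∑ m ∈ Icc 1 M, ∑ n ∈ Icc 1 (M / m), Λ n / Real.sqrt n * (c (m * n) * c m)| ≤
      (Real.log M + 6) * ∑ k ∈ Icc 1 M, c k ^ 2 := by
  refine (two_mul_abs_vonMangoldtCoupling_le M c).trans ?_
  rw [mul_sum]
  refine sum_le_sum fun k hk => ?_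
  have h1 := sum_vonMangoldt_div_self_le_log_sub (M := M) (k := k) hk
  have hcoef : Real.log k + ∑ n ∈ Icc 1 (M / k), Λ n / n ≤ Real.log M + 6 := by linarith
  exact mul_le_mul_of_nonneg_right hcoef (sq_nonneg _)


/-! ### The flat vector: `2 B_M(m^{-1/2}) ≥ (log M − 13)·H_M` (PIVOT-LAW §13.2, LEMMA N (ii), lower half)

Together with `two_mul_abs_vonMangoldtCoupling_le_log` this makes the order of the top eigenvalue of the
von Mangoldt coupling matrix a kernel fact: `log M − 13 ≤ ν_max(N_M) ≤ log M + 6`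
(numerically `ν_max(N_M) = log M − γ₀ + O(1/log M)`; PIVOT-LAW §13.7 Prop. N2 proves `log M − γ₀ + o(1)`
from the prime number theorem). -/

/-- Harmonic lower bound: `log (M+1) ≤ ∑_{m ≤ M} 1/m`. -/
theorem log_succ_le_harmonicSum (M : ℕ) :
    Real.log ((M : ℝ) + 1) ≤ ∑ m ∈ Icc 1 M, (1 : ℝ) / m := by
  induction M with
  | zero => simp
  | succ M ih =>
    rw [sum_Icc_succ_top (by omega), Nat.cast_succ]
    have hM1 : (0 : ℝ) < (M : ℝ) + 1 := by positivity
    have hstep : Real.log ((M : ℝ) + 1 + 1) - Real.log ((M : ℝ) + 1) ≤ 1 / ((M : ℝ) + 1) := by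
      rw [← Real.log_div (by positivity) hM1.ne']
      have h := Real.log_le_sub_one_of_pos (show (0 : ℝ) < ((M : ℝ) + 1 + 1) / ((M : ℝ) + 1) by positivity)
      have heq : ((M : ℝ) + 1 + 1) / ((M : ℝ) + 1) - 1 = 1 / ((M : ℝ) + 1) := by
        field_simp; ring
      linarith
    linarith

/-- Harmonic upper bound: `∑_{m ≤ M} 1/m ≤ log M + 1` for `M ≥ 1`. -/
theorem harmonicSum_le_log_add_one {M : ℕ} (hM : 1 ≤ M) :
    ∑ m ∈ Icc 1 M, (1 : ℝ) / m ≤ Real.log M + 1 := by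
  induction M, hM using Nat.le_induction with
  | base => simp
  | succ M hM ih =>
    rw [sum_Icc_succ_top (by omega), Nat.cast_succ]
    have hM0 : (0 : ℝ) < M := by exact_mod_cast hM
    have hstep : 1 / ((M : ℝ) + 1) ≤ Real.log ((M : ℝ) + 1) - Real.log M := by
      rw [← Real.log_div (by positivity) hM0.ne']
      have h := Real.one_sub_inv_le_log_of_pos (show (0 : ℝ) < ((M : ℝ) + 1) / M by positivity)
      have heq : 1 - (((M : ℝ) + 1) / M)⁻¹ = 1 / ((M : ℝ) + 1) := by
        field_simp; ring
      linarith
    linarith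

/-- One telescoping step for `∑ log m / m`: for `m ≥ 2`,
`log m / m ≤ ½ (log² m − log² (m−1)) + 1/(2 m (m−1))`, from `1 − 1/x ≤ log x ≤ x − 1`. -/
theorem log_div_le_telescope {m : ℕ} (hm : 2 ≤ m) :
    Real.log m / m ≤ (Real.log m ^ 2 - Real.log ((m : ℝ) - 1) ^ 2) / 2 + 1 / (2 * m * ((m : ℝ) - 1)) := by
  have hm0 : (0 : ℝ) < m := by exact_mod_cast (show 0 < m by omega)
  have hm1 : (0 : ℝ) < (m : ℝ) - 1 := by
    have : (2 : ℝ) ≤ m := by exact_mod_cast hm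
    linarith
  set a := Real.log m with ha
  set b := Real.log ((m : ℝ) - 1) with hb
  have hab : a - b = Real.log ((m : ℝ) / ((m : ℝ) - 1)) := by
    rw [ha, hb, Real.log_div hm0.ne' hm1.ne']
  have hq : (0 : ℝ) < (m : ℝ) / ((m : ℝ) - 1) := by positivity
  -- lower bound: a - b ≥ 1/m
  have hlow : 1 / (m : ℝ) ≤ a - b := by
    rw [hab]
    have h := Real.one_sub_inv_le_log_of_pos hq
    have heq : 1 - ((m : ℝ) / ((m : ℝ) - 1))⁻¹ = 1 / (m : ℝ) := by field_simp; ring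
    linarith
  -- upper bound: a - b ≤ 1/(m-1)
  have hup : a - b ≤ 1 / ((m : ℝ) - 1) := by
    rw [hab]
    have h := Real.log_le_sub_one_of_pos hq
    have heq : (m : ℝ) / ((m : ℝ) - 1) - 1 = 1 / ((m : ℝ) - 1) := by field_simp; ring
    linarith
  have hm2 : (2 : ℝ) ≤ m := by exact_mod_cast hm
  have hb0 : 0 ≤ b := by
    rw [hb]; exact Real.log_nonneg (by linarith)
  have ha0 : 0 ≤ a := by rw [ha]; exact Real.log_nonneg (by linarith)
  -- (a² - b²)/2 = (a-b)(a+b)/2 ≥ (1/m)(a+b)/2 and a + b = 2a - (a-b) ≥ 2a - 1/(m-1)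
  have h1 : (a ^ 2 - b ^ 2) / 2 = (a - b) * (a + b) / 2 := by ring
  have h2 : 1 / (m : ℝ) * (a + b) ≤ (a - b) * (a + b) :=
    mul_le_mul_of_nonneg_right hlow (by linarith)
  have h3 : 1 / (m : ℝ) * (2 * a - 1 / ((m : ℝ) - 1)) ≤ 1 / (m : ℝ) * (a + b) :=
    mul_le_mul_of_nonneg_left (by linarith) (by positivity)
  have h4 : 1 / (m : ℝ) * (2 * a - 1 / ((m : ℝ) - 1)) / 2 + 1 / (2 * m * ((m : ℝ) - 1)) = a / m := by
    have hmne : (m : ℝ) ≠ 0 := hm0.ne'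
    have hm1ne : (m : ℝ) - 1 ≠ 0 := hm1.ne'
    field_simp
    ring
  rw [h1]
  have h5 : Real.log m / m = a / m := by rw [ha]
  rw [h5]
  linarith [h2, h3, h4]

/-- `∑_{m ≤ M} log m / m ≤ ½ log² M + ½ − 1/(2M)` for `M ≥ 1` (so `≤ ½ log² M + ½`). -/
theorem sum_log_div_le (M : ℕ) (hM : 1 ≤ M) :
    ∑ m ∈ Icc 1 M, Real.log m / m ≤ Real.log M ^ 2 / 2 + 1 / 2 - 1 / (2 * (M : ℝ)) := by
  induction M, hM using Nat.le_induction with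
  | base => simp
  | succ M hM ih =>
    rw [sum_Icc_succ_top (by omega)]
    have hstep := log_div_le_telescope (m := M + 1) (by omega)
    have hcast : ((M + 1 : ℕ) : ℝ) - 1 = (M : ℝ) := by push_cast; ring
    rw [hcast] at hstep
    have hM0 : (0 : ℝ) < M := by exact_mod_cast hM
    have hfrac : 1 / (2 * ((M + 1 : ℕ) : ℝ) * (M : ℝ)) = 1 / (2 * (M : ℝ)) - 1 / (2 * ((M + 1 : ℕ) : ℝ)) := by
      push_cast; field_simp; ring
    rw [hfrac] at hstep
    linarith

/-- The flat term: `Λ(n) n^{-1/2} · (mn)^{-1/2} · m^{-1/2} = Λ(n)/n · 1/m` for `m, n ≥ 1`. -/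
theorem vonMangoldt_flat_term {m n : ℕ} (hm : 1 ≤ m) (hn : 1 ≤ n) :
    Λ n / Real.sqrt n * ((Real.sqrt ((m * n : ℕ) : ℝ))⁻¹ * (Real.sqrt m)⁻¹) = Λ n / n * (1 / m) := by
  have hm0 : (0 : ℝ) < m := by exact_mod_cast hm
  have hn0 : (0 : ℝ) < n := by exact_mod_cast hn
  have hsm : 0 < Real.sqrt m := Real.sqrt_pos.mpr hm0
  have hsn : 0 < Real.sqrt n := Real.sqrt_pos.mpr hn0
  rw [Nat.cast_mul, Real.sqrt_mul hm0.le]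
  have hm2 : Real.sqrt m * Real.sqrt m = m := Real.mul_self_sqrt hm0.le
  have hn2 : Real.sqrt n * Real.sqrt n = n := Real.mul_self_sqrt hn0.le
  calc Λ n / Real.sqrt n * ((Real.sqrt m * Real.sqrt n)⁻¹ * (Real.sqrt m)⁻¹)
      = Λ n * ((Real.sqrt n * Real.sqrt n)⁻¹ * (Real.sqrt m * Real.sqrt m)⁻¹) := by ring
    _ = Λ n * (((n : ℝ))⁻¹ * ((m : ℝ))⁻¹) := by rw [hn2, hm2]
    _ = Λ n / n * (1 / m) := by ring

/-- `∑_{n ≤ M/m} Λ(n)/n ≥ log M − log m − 6` for `1 ≤ m ≤ M` (the tree's Mertens bound at `x = M/m`). -/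
theorem log_sub_le_sum_vonMangoldt_div_self {M m : ℕ} (hm : m ∈ Icc 1 M) :
    Real.log M - Real.log m - 6 ≤ ∑ n ∈ Icc 1 (M / m), Λ n / n := by
  obtain ⟨hm1, hmM⟩ := mem_Icc.1 hm
  have hm0 : (0 : ℝ) < m := by exact_mod_cast hm1
  have hM0 : (0 : ℝ) < M := by exact_mod_cast (show 0 < M by omega)
  have hx : (1 : ℝ) ≤ (M : ℝ) / m := by
    rw [le_div_iff₀ hm0, one_mul]; exact_mod_cast hmM
  have h := Literature.NumberTheory.Sieve.SelbergSymmetry.abs_sum_vonMangoldt_div_sub_log_le hx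
  rw [Nat.floor_div_eq_div] at h
  have hI : Icc 1 (M / m) = Ioc 0 (M / m) := by ext k; simp only [mem_Icc, mem_Ioc]; omega
  rw [hI, ← Real.log_div hM0.ne' hm0.ne']
  have := (abs_le.1 h).1
  linarith

/-- **LEMMA N (ii), lower half** (PIVOT-LAW §13.2): on the flat vector `c_m = m^{-1/2}` the coupling form
is at least `(log M − 13)·∑_{m ≤ M} 1/m`; hence `ν_max(N_M) ≥ log M − 13`. -/
theorem vonMangoldtCoupling_flat_ge (M : ℕ) (hM : 1 ≤ M) :
    (Real.log M - 13) * ∑ m ∈ Icc 1 M, (1 : ℝ) / m ≤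
      2 * ∑ m ∈ Icc 1 M, ∑ n ∈ Icc 1 (M / m),
        Λ n / Real.sqrt n * ((Real.sqrt ((m * n : ℕ) : ℝ))⁻¹ * (Real.sqrt m)⁻¹) := by
  -- rewrite the flat form as ∑_m (1/m) ∑_{n ≤ M/m} Λ(n)/n
  have hform : ∑ m ∈ Icc 1 M, ∑ n ∈ Icc 1 (M / m),
        Λ n / Real.sqrt n * ((Real.sqrt ((m * n : ℕ) : ℝ))⁻¹ * (Real.sqrt m)⁻¹) =
      ∑ m ∈ Icc 1 M, (1 / (m : ℝ)) * ∑ n ∈ Icc 1 (M / m), Λ n / n := by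
    refine sum_congr rfl fun m hm => ?_
    rw [mul_sum]
    refine sum_congr rfl fun n hn => ?_
    rw [vonMangoldt_flat_term (mem_Icc.1 hm).1 (mem_Icc.1 hn).1, mul_comm]
  rw [hform]
  -- termwise Mertens lower bound
  have hlow : ∑ m ∈ Icc 1 M, (1 / (m : ℝ)) * (Real.log M - Real.log m - 6) ≤
      ∑ m ∈ Icc 1 M, (1 / (m : ℝ)) * ∑ n ∈ Icc 1 (M / m), Λ n / n := by
    refine sum_le_sum fun m hm => ?_
    exact mul_le_mul_of_nonneg_left (log_sub_le_sum_vonMangoldt_div_self hm) (by positivity)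
  -- expand the left side
  have hexp : ∑ m ∈ Icc 1 M, (1 / (m : ℝ)) * (Real.log M - Real.log m - 6) =
      (Real.log M - 6) * ∑ m ∈ Icc 1 M, (1 : ℝ) / m - ∑ m ∈ Icc 1 M, Real.log m / m := by
    rw [mul_sum, ← sum_sub_distrib]
    refine sum_congr rfl fun m _ => ?_
    ring
  have hH := log_succ_le_harmonicSum M
  have hlogM : Real.log M ≤ ∑ m ∈ Icc 1 M, (1 : ℝ) / m := by
    refine le_trans (Real.log_le_log (by exact_mod_cast hM) (by linarith)) hH
  have hH1 : (1 : ℝ) ≤ ∑ m ∈ Icc 1 M, (1 : ℝ) / m := by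
    have hsub : Icc (1 : ℕ) 1 ⊆ Icc 1 M := Icc_subset_Icc_right hM
    have h1 := sum_le_sum_of_subset_of_nonneg hsub (f := fun m : ℕ => (1 : ℝ) / (m : ℝ))
      (fun i _ _ => by positivity)
    simpa using h1
  have hS := sum_log_div_le M hM
  have hM0 : (0 : ℝ) < M := by exact_mod_cast hM
  have hlogM0 : 0 ≤ Real.log M := Real.log_nonneg (by exact_mod_cast hM)
  -- ∑ log m/m ≤ (log² M + 1)/2 ≤ (H·log M + H)/2
  have hS2 : ∑ m ∈ Icc 1 M, Real.log m / m ≤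
      ((∑ m ∈ Icc 1 M, (1 : ℝ) / m) * Real.log M + ∑ m ∈ Icc 1 M, (1 : ℝ) / m) / 2 := by
    have h1 : Real.log M ^ 2 ≤ (∑ m ∈ Icc 1 M, (1 : ℝ) / m) * Real.log M := by
      rw [sq]; exact mul_le_mul_of_nonneg_right hlogM hlogM0
    have h2 : 1 / 2 - 1 / (2 * (M : ℝ)) ≤ (∑ m ∈ Icc 1 M, (1 : ℝ) / m) / 2 := by
      have : 0 ≤ 1 / (2 * (M : ℝ)) := by positivity
      linarith
    linarith
  nlinarith [hlow, hexp, hS2, hH1, hlogM0]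

end Summit.RiemannHypothesis.RiemannHypothesis.Theorems.IntegerScrew

end
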